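import Literature.MathematicalPhysics.QuantumFieldTheory.Balaban1983to89.T3AlphaInputsACTwoRunLevel
import Literature.MathematicalPhysics.QuantumFieldTheory.Balaban1983to89.T3CruxEstimates
import Literature.MathematicalPhysics.QuantumFieldTheory.Balaban1983to89.T3Thresholds
import Summits.QuantumFields.YangMills.Theorems.UnitScaleTiltFluctuationComparisonRegPrTwoRunGeometry
import HarnessLib

/-!
# Route `UnitScaleTilt` — crux K1bR-pr `FluctuationComparisonRegPr` (stmt-QuantumFields-19201), S-E″ bookkeeping, part 1: THE PER-POLYMER ESTIMATE
# (support file `--supports stmt-QuantumFields-19201`)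

Fleet lead `ym-ust-19201-p2` (gen 2, socket pen); FINDING-19201-SE2-scaling (evidence #53 on the item).  The deterministic heart of the S-E″ rung
`PolymerCauchyAt D b₀ p₀ m ⇐ per-run clauses + TwoRunLv + MinimiserCauchyAt`: for one cut-off `K`, one comparison height `n ≤ K`, one step `j < K − n`, one
localisation domain `Y` of run `K` at level `i = 1+j`, and one `θ(n)`-small datum `V`, with `U = U_k(V)` and `U′ = U_{k+1}(V)` the two runs' trivial-history
composite minimisers (`k = K − n`):
`|𝒫′_{i+1}(refine Y, U′) − 𝒫_i(Y, U) − c| ≤ |𝒫′_{i+1}(refine Y, U′) − 𝒫_i(Y, coarsen U′) − c| + |𝒫_i(Y, coarsen U′) − 𝒫_i(Y, U)|`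
`≤ C·e^{−κ₁𝓛}θ(n)²L^{−4(k−i)}L^{−a·i}` (`PolymerCauchyLvAt` at the canonical matched background, guard = (68) at the trivial history of run `K+1`)
`+ CL·e^{−κ₁𝓛}t²(Lⁱ·dist)/α₁` (`PtermLipschitz`, `t = 302·C68⁺θ(n)L^{−2(k−i)}` from (68) of run `K` and the one-step averaging bound `plaqSmall_coarsenField`
p462338, `Lⁱ·dist ≤ Lⁱ·C_mc θ(n) L^{−(2+a₁)k}` from `MinimiserCauchyAt` through `orbitDistOn_mono`), under the three GUARDS `302·C68⁺θ(n) ≤ t₀`,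
`C_mc⁺θ(n) ≤ α₁/2`, `(25/2)·C68⁺θ(n) ≤ deltaSU/2` (which hold for `n` large, part 3).  Plus the SIZE facts used off the guards and for the extra finest slice
(`TermSize` at the trivial history of either run).  WHAT THIS IS NOT: no estimate of Bałaban's or King's is asserted — every analytic input is a hypothesis schema
of `T3AlphaInputsAC`/`…TwoRun`/`…TwoRunLevel`.

References: C. King, CMP 102 (1986) 649–677 [King1986] (Thm 3.4 (3.9) p.656; Prop. 3.9 (3.73)–(3.75) p.665, p.675); T. Bałaban, CMP 102 (1985) 255–275
[Balaban1985UV3] ((44)–(46) p.267, (68) p.273); CMP 109 (1987) 249–301 [Balaban1987RG1] ((1.18) p.263).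
-/

noncomputable section

open MeasureTheory Filter Topology
open Literature.MathematicalPhysics.QuantumFieldTheory.Balaban1983to89
open Literature.MathematicalPhysics.QuantumFieldTheory.Balaban1983to89.T3ContinuumYM3Torus
open Literature.MathematicalPhysics.QuantumFieldTheory.Balaban1983to89.T3LevelShift
open Literature.MathematicalPhysics.QuantumFieldTheory.Balaban1983to89.T3UnitLawDensityEML (ℰp measurableE_ℰp)
open Literature.MathematicalPhysics.QuantumFieldTheory.Balaban1983to89.T3UnitScaleTilt
open Literature.MathematicalPhysics.QuantumFieldTheory.Balaban1983to89.T3TiltDescent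
open Literature.MathematicalPhysics.QuantumFieldTheory.Balaban1983to89.T3PrintedRegularMinimiser
open Literature.MathematicalPhysics.QuantumFieldTheory.Balaban1983to89.T3AlphaInputsAC
open Literature.MathematicalPhysics.QuantumFieldTheory.Balaban1983to89.T3AlphaPolymerSocket
open Literature.MathematicalPhysics.QuantumFieldTheory.Balaban1983to89.T3AlphaInputsACTwoRun
open Literature.MathematicalPhysics.QuantumFieldTheory.Balaban1983to89.T3AlphaInputsACTwoRunLevel
open Literature.MathematicalPhysics.QuantumFieldTheory.Balaban1983to89.B10Eq38TorusDomains (plaqsIn mem_plaqsIn_iff)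
open Literature.MathematicalPhysics.QuantumFieldTheory.Balaban1983to89.B10Eq42TorusConstraint (bondsIn lam42 lam42_self)
open Literature.MathematicalPhysics.QuantumFieldTheory.Balaban1983to89.ExpMeanLog (deltaSU deltaSU_pos)
open Literature.MathematicalPhysics.QuantumFieldTheory.Balaban1983to89.Missing
open Summit.QuantumFields.YangMills.Theorems.LogComparisonTwoRunGeometry (plaqSmall_coarsenField)

namespace Summit.QuantumFields.YangMills.Theorems.LogComparisonPolymerEstimate

variable {F : T3Family} {γ : ℝ} (D : AlphaDataT3 F γ) {b₀ p₀ : ℝ}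

/-! ## §1 Regularity (68) at the trivial history: all fine plaquettes of `U_k(V)` are `≤ C68·θ(n)·L^{−2k}` -/

/-- **(68) AT THE TRIVIAL HISTORY, GLOBALLY**: for a `θ(n)`-small datum `V` at height `n ≤ K`, every fine plaquette of run `K`'s trivial-history composite minimiser
`U_k(V)` (`k = K − n`) is within `C68·θ(n)·L^{−2k}` of `1` — `Regularity68` at the top region, which is the whole torus under `TrivRegions` (`lam42_self`), the pair
being admissible by `AdmOnSmall`. [cite: Balaban1985UV3, (68) p.273] -/
theorem plaq_umin_triv_le {C68 : ℝ} (hAdm : AdmOnSmall D b₀ p₀) (hTriv : TrivRegions D) (h68 : Regularity68 D b₀ p₀ C68)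
    {K n : ℕ} (h : n ≤ K) (V : GaugeField (F.P n) 0 (Matrix.specialUnitaryGroup (Fin 2) ℂ)) (hV : PlaqSmall (θBal F.L γ b₀ p₀ n) V)
    (q : Plaq (F.P K) 0) :
    GaugeGroup.dist1 (GaugeField.plaqHol (D.Umin K (K - n) (D.triv K (K - n))
        (fieldShift (F.sitesPerDir_eq (m := F.m) (K := K) (j := K - n) (m' := F.m) (K' := n) (j' := 0) (by omega)) V)) q) ≤
      C68 * θBal F.L γ b₀ p₀ n * (((F.L : ℝ) ^ (K - n))⁻¹) ^ 2 := by
  set W := fieldShift (F.sitesPerDir_eq (m := F.m) (K := K) (j := K - n) (m' := F.m) (K' := n) (j' := 0) (by omega)) V with hW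
  have hKn : K - (K - n) = n := Nat.sub_sub_self h
  have hWs : PlaqSmall (θBal F.L γ b₀ p₀ (K - (K - n))) W := by
    rw [hKn, hW]
    exact (T3CruxEstimates.plaqSmall_fieldShift F _ _ V).mpr hV
  have hadm : D.Adm K (K - n) (D.triv K (K - n)) W := hAdm K (K - n) W (Nat.sub_le K n) hWs
  have hq : q ∈ plaqsIn 0 (D.Λ K (K - n) (D.triv K (K - n)) (K - n)) := by
    rw [mem_plaqsIn_iff]
    show (B10Eq38TorusDomains.cornerSet 0 q : Set (Site (F.P K) 0)) ⊆ lam42 (D.Ω K (K - n) (D.triv K (K - n))) (K - n) (K - n)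
    rw [lam42_self, hTriv]
    exact Set.subset_univ _
  have := h68 K (K - n) (D.triv K (K - n)) W (Nat.sub_le K n) hadm (K - n) le_rfl q hq
  rwa [hKn] at this

/-! ## §2 The size facts at the trivial history (TermSize under AdmOnSmall) -/

/-- **THE PRINTED SIZE (44) OF ONE TERM AT THE TRIVIAL-HISTORY MINIMISER OF A SMALL DATUM**: run `K`, height `n ≤ K`, level `1 ≤ i ≤ K − n`, `Y ∈ Loc`:
`|𝒫_i(Y, U_k(V))| ≤ C·e^{−κ₁𝓛(Y)}·θ(n+1)²·L^{−4(k−i)}`. [cite: Balaban1985UV3, (44) p.267] -/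
theorem abs_pterm_umin_triv_le {C κ₁ : ℝ} (hAdm : AdmOnSmall D b₀ p₀) (hTS : TermSize D b₀ p₀ C κ₁)
    {K n : ℕ} (h : n ≤ K) (V : GaugeField (F.P n) 0 (Matrix.specialUnitaryGroup (Fin 2) ℂ)) (hV : PlaqSmall (θBal F.L γ b₀ p₀ n) V)
    {i : ℕ} (hi1 : 1 ≤ i) (hik : i ≤ K - n) {Y : Set (Site (F.P K) 0)} (hY : Y ∈ D.Loc K (K - n) (D.triv K (K - n)) i) :
    |D.Pterm K i Y (D.Umin K (K - n) (D.triv K (K - n))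
        (fieldShift (F.sitesPerDir_eq (m := F.m) (K := K) (j := K - n) (m' := F.m) (K' := n) (j' := 0) (by omega)) V))| ≤
      C * Real.exp (-κ₁ * D.treeLen K i Y) * θBal F.L γ b₀ p₀ (n + 1) ^ 2 * (((F.L : ℝ) ^ (K - n - i))⁻¹) ^ 4 := by
  set W := fieldShift (F.sitesPerDir_eq (m := F.m) (K := K) (j := K - n) (m' := F.m) (K' := n) (j' := 0) (by omega)) V with hW
  have hKn : K - (K - n) = n := Nat.sub_sub_self h
  have hWs : PlaqSmall (θBal F.L γ b₀ p₀ (K - (K - n))) W := by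
    rw [hKn, hW]
    exact (T3CruxEstimates.plaqSmall_fieldShift F _ _ V).mpr hV
  have hadm : D.Adm K (K - n) (D.triv K (K - n)) W := hAdm K (K - n) W (Nat.sub_le K n) hWs
  have := hTS.2 K (K - n) (D.triv K (K - n)) W (Nat.sub_le K n) hadm i hi1 hik Y hY
  rwa [hKn] at this

/-! ## §3 The per-polymer matched estimate under the guards -/

/-- `((L^a)⁻¹)^2 · ((L^b)⁻¹)^2 = ((L^{a+b})⁻¹)^2` (bookkeeping). [folklore] -/
private theorem inv_pow_sq_mul (x : ℝ) (a b : ℕ) : ((x ^ a)⁻¹) ^ 2 * ((x ^ b)⁻¹) ^ 2 = ((x ^ (a + b))⁻¹) ^ 2 := by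
  rw [pow_add, mul_inv, mul_pow]

/-- `((L^a)⁻¹)^c ≤ 1` for `1 ≤ L` (bookkeeping). [folklore] -/
private theorem inv_pow_pow_le_one {x : ℝ} (hx : 1 ≤ x) (a c : ℕ) : ((x ^ a)⁻¹) ^ c ≤ 1 :=
  pow_le_one₀ (inv_nonneg.mpr (by positivity)) (inv_le_one_of_one_le₀ (one_le_pow₀ hx))

/-- **THE PER-POLYMER MATCHED ESTIMATE** (the deterministic heart of S-E″): at cut-off `K`, height `n ≤ K`, step `j < K − n` (level `i = 1+j`), for a run-`K`
localisation domain `Y` of level `i` at the trivial history and a `θ(n)`-small datum `V`, under the three guards at height `n`,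
`|𝒫′_{i+1}(refineSet Y, U_{k+1}(V)) − 𝒫_i(Y, U_k(V)) − c K n j Y|`
`≤ C⁺e^{−κ₁𝓛(Y)}θ(n)²L^{−4(k−i)}(L^{−i})^{a} + (CL⁺(151(C68⁺+1))²C_mc⁺/α₁)·θ(n)³·e^{−κ₁𝓛(Y)}·L^{−4(k−i)}·(L^{−i})^{a₁}`
— `PolymerCauchyLvAt` at the canonical matched background `coarsenField U′` (guard: (68) for run `K+1`) plus `PtermLipschitz` × the minimiser closeness
`MinimiserCauchyAt` (plaquette guards from (68) for run `K` and `plaqSmall_coarsenField`; radius guard from `orbitDistOn_mono`). [cite: King1986, Prop. 3.9 (3.73)-(3.74) p.665] -/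
theorem abs_matched_sub_le {C68 κ₁ a C CL α₁ t₀ Cmc a₁ ε₀ : ℝ}
    (hL : 1 < F.L) (hγ : 0 < γ) (hγ1 : γ ≤ 1) (hb : 0 < b₀) (ha₁ : 0 ≤ a₁)
    (hAdm : AdmOnSmall D b₀ p₀) (hUmin : UminTrivIsRegMinimiser D b₀ p₀ ε₀) (hTriv : TrivRegions D) (h68 : Regularity68 D b₀ p₀ C68)
    (hLip : PtermLipschitz D CL κ₁ α₁ t₀)
    {c : (K n j : ℕ) → Set (Site (F.P K) 0) → ℝ}
    (hLv : ∀ (K n : ℕ), n ≤ K → ∀ j : ℕ, j < K - n →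
      ∀ U' : GaugeField (F.P (K + 1)) 0 (Matrix.specialUnitaryGroup (Fin 2) ℂ),
        (∀ q : Plaq (F.P (K + 1)) 0,
          GaugeGroup.dist1 (GaugeField.plaqHol U' q) ≤ C68 * θBal F.L γ b₀ p₀ n * (((F.L : ℝ) ^ (K + 1 - n))⁻¹) ^ 2) →
        ∀ Y ∈ D.Loc K (K - n) (D.triv K (K - n)) (1 + j), |D.Pterm (K + 1) (1 + (j + 1)) (refineSet F K Y) U' -
            D.Pterm K (1 + j) Y (coarsenField F K U') - c K n j Y| ≤
            C * Real.exp (-κ₁ * D.treeLen K (1 + j) Y) * θBal F.L γ b₀ p₀ n ^ 2 *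
              (((F.L : ℝ) ^ (K - n - 1 - j))⁻¹) ^ 4 * (((F.L : ℝ) ^ (1 + j))⁻¹) ^ a)
    (hMC : ∀ (K n : ℕ) (h : n ≤ K) (V : GaugeField (F.P n) 0 (Matrix.specialUnitaryGroup (Fin 2) ℂ)),
      PlaqSmall (θBal F.L γ b₀ p₀ n) V →
        ∀ U ∈ regFibrePr F n K h ε₀ V, wilsonAction4 U = minActionRegPr F n K h ε₀ V →
          ∀ U' ∈ regFibrePr F n (K + 1) (h.trans (Nat.le_succ K)) ε₀ V,
            wilsonAction4 U' = minActionRegPr F n (K + 1) (h.trans (Nat.le_succ K)) ε₀ V →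
              orbitDistOn F Set.univ (coarsenField F K U') U ≤
                Cmc * θBal F.L γ b₀ p₀ n * (((F.L : ℝ) ^ (K - n))⁻¹) ^ 2 * (((F.L : ℝ) ^ (K - n))⁻¹) ^ a₁)
    {K n : ℕ} (h : n ≤ K) {j : ℕ} (hj : j < K - n) {Y : Set (Site (F.P K) 0)} (hY : Y ∈ D.Loc K (K - n) (D.triv K (K - n)) (1 + j))
    (V : GaugeField (F.P n) 0 (Matrix.specialUnitaryGroup (Fin 2) ℂ)) (hV : PlaqSmall (θBal F.L γ b₀ p₀ n) V)
    (hg1 : 151 * (max C68 0 + 1) * θBal F.L γ b₀ p₀ n ≤ t₀) (hg2 : max Cmc 0 * θBal F.L γ b₀ p₀ n ≤ α₁ / 2)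
    (hg3 : 25 / 4 * (max C68 0 + 1) * θBal F.L γ b₀ p₀ n ≤ deltaSU (Fin 2) / 2) :
    |D.Pterm (K + 1) (1 + (j + 1)) (refineSet F K Y) (D.Umin (K + 1) (K + 1 - n) (D.triv (K + 1) (K + 1 - n))
          (fieldShift (F.sitesPerDir_eq (m := F.m) (K := K + 1) (j := K + 1 - n) (m' := F.m) (K' := n) (j' := 0) (by omega)) V)) -
        D.Pterm K (1 + j) Y (D.Umin K (K - n) (D.triv K (K - n))
          (fieldShift (F.sitesPerDir_eq (m := F.m) (K := K) (j := K - n) (m' := F.m) (K' := n) (j' := 0) (by omega)) V)) -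
        c K n j Y| ≤
      max C 0 * Real.exp (-κ₁ * D.treeLen K (1 + j) Y) * θBal F.L γ b₀ p₀ n ^ 2 *
          (((F.L : ℝ) ^ (K - n - 1 - j))⁻¹) ^ 4 * (((F.L : ℝ) ^ (1 + j))⁻¹) ^ a +
        max CL 0 * (151 * (max C68 0 + 1)) ^ 2 * max Cmc 0 / α₁ * θBal F.L γ b₀ p₀ n ^ 3 *
          Real.exp (-κ₁ * D.treeLen K (1 + j) Y) * (((F.L : ℝ) ^ (K - n - 1 - j))⁻¹) ^ 4 * (((F.L : ℝ) ^ (1 + j))⁻¹) ^ a₁ := by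
  -- names
  set θ := θBal F.L γ b₀ p₀ n with hθdef
  set Lr : ℝ := (F.L : ℝ) with hLr
  set k := K - n with hk
  set U := D.Umin K (K - n) (D.triv K (K - n))
    (fieldShift (F.sitesPerDir_eq (m := F.m) (K := K) (j := K - n) (m' := F.m) (K' := n) (j' := 0) (by omega)) V) with hU
  set U' := D.Umin (K + 1) (K + 1 - n) (D.triv (K + 1) (K + 1 - n))
    (fieldShift (F.sitesPerDir_eq (m := F.m) (K := K + 1) (j := K + 1 - n) (m' := F.m) (K' := n) (j' := 0) (by omega)) V) with hU'
  set E := Real.exp (-κ₁ * D.treeLen K (1 + j) Y) with hE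
  set C68p : ℝ := max C68 0 + 1 with hC68p
  have hL1 : (1 : ℝ) ≤ Lr := by rw [hLr]; exact_mod_cast hL.le
  have hL0 : (0 : ℝ) < Lr := by linarith
  have hθ0 : 0 < θ := T3MinimiserStabilityReduction.θBal_pos hL.le hγ hγ1 hb p₀ n
  have hC68 : C68 ≤ C68p - 1 := by rw [hC68p]; simp
  have hC68p0 : 0 < C68p := by rw [hC68p]; positivity
  have hE0 : 0 < E := Real.exp_pos _
  have hik : 1 + j ≤ k := by omega
  have hki : K - n - 1 - j = k - (1 + j) := by omega
  have hα : 0 < α₁ := hLip.1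
  -- (68) for both runs' trivial-history minimisers
  have hplU : ∀ q, GaugeGroup.dist1 (GaugeField.plaqHol U q) ≤ C68 * θ * ((Lr ^ k)⁻¹) ^ 2 :=
    fun q => plaq_umin_triv_le D hAdm hTriv h68 h V hV q
  have h' : n ≤ K + 1 := h.trans (Nat.le_succ K)
  have hk1 : K + 1 - n = k + 1 := by omega
  have hplU' : ∀ q, GaugeGroup.dist1 (GaugeField.plaqHol U' q) ≤ C68 * θ * ((Lr ^ (K + 1 - n))⁻¹) ^ 2 :=
    fun q => plaq_umin_triv_le D hAdm hTriv h68 h' V hV q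
  -- first piece: the comparison at the canonical matched background
  have h1 : |D.Pterm (K + 1) (1 + (j + 1)) (refineSet F K Y) U' - D.Pterm K (1 + j) Y (coarsenField F K U') - c K n j Y| ≤
      C * E * θ ^ 2 * ((Lr ^ (K - n - 1 - j))⁻¹) ^ 4 * ((Lr ^ (1 + j))⁻¹) ^ a :=
    hLv K n h j hj U' hplU' Y hY
  have hX0 : 0 ≤ E * θ ^ 2 * ((Lr ^ (K - n - 1 - j))⁻¹) ^ 4 * ((Lr ^ (1 + j))⁻¹) ^ a := by positivity
  have h1' : |D.Pterm (K + 1) (1 + (j + 1)) (refineSet F K Y) U' - D.Pterm K (1 + j) Y (coarsenField F K U') - c K n j Y| ≤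
      max C 0 * E * θ ^ 2 * ((Lr ^ (K - n - 1 - j))⁻¹) ^ 4 * ((Lr ^ (1 + j))⁻¹) ^ a := by
    refine h1.trans ?_
    have := mul_le_mul_of_nonneg_right (le_max_left C 0) hX0
    linarith [this]
  -- the minimisers and their closeness (e1)
  have hUreg := hUmin K n h V hV
  have hU'reg := hUmin (K + 1) n h' V hV
  have hdist : orbitDistOn F Set.univ (coarsenField F K U') U ≤ Cmc * θ * ((Lr ^ k)⁻¹) ^ 2 * ((Lr ^ k)⁻¹) ^ a₁ :=
    hMC K n h V hV U hUreg.1 hUreg.2 U' hU'reg.1 hU'reg.2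
  have hxk0 : 0 < ((Lr ^ k)⁻¹) := by positivity
  have hxk1 : ((Lr ^ k)⁻¹) ≤ 1 := inv_le_one_of_one_le₀ (one_le_pow₀ hL1)
  have hra1 : ((Lr ^ k)⁻¹) ^ a₁ ≤ 1 := Real.rpow_le_one hxk0.le hxk1 ha₁
  have hdist' : orbitDistOn F Set.univ (coarsenField F K U') U ≤ max Cmc 0 * θ * ((Lr ^ k)⁻¹) ^ 2 * ((Lr ^ k)⁻¹) ^ a₁ := by
    refine hdist.trans ?_
    have h0 : 0 ≤ θ * ((Lr ^ k)⁻¹) ^ 2 * ((Lr ^ k)⁻¹) ^ a₁ := by positivity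
    have := mul_le_mul_of_nonneg_right (le_max_left Cmc 0) h0
    linarith [this]
  -- plaquettes of the run-(K+1) minimiser, as a strict window
  have haU' : PlaqSmall (C68p * θ * ((Lr ^ (k + 1))⁻¹) ^ 2) U' := by
    intro q
    have hq := hplU' q
    rw [hk1] at hq
    have hx : 0 < θ * ((Lr ^ (k + 1))⁻¹) ^ 2 := by positivity
    calc GaugeGroup.dist1 (GaugeField.plaqHol U' q) ≤ C68 * θ * ((Lr ^ (k + 1))⁻¹) ^ 2 := hq
      _ = C68 * (θ * ((Lr ^ (k + 1))⁻¹) ^ 2) := by ring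
      _ ≤ (C68p - 1) * (θ * ((Lr ^ (k + 1))⁻¹) ^ 2) := mul_le_mul_of_nonneg_right hC68 hx.le
      _ < C68p * (θ * ((Lr ^ (k + 1))⁻¹) ^ 2) := by nlinarith
      _ = C68p * θ * ((Lr ^ (k + 1))⁻¹) ^ 2 := by ring
  have ha0 : 0 ≤ C68p * θ * ((Lr ^ (k + 1))⁻¹) ^ 2 := by positivity
  have hsq : Lr ^ 2 * ((Lr ^ (k + 1))⁻¹) ^ 2 = ((Lr ^ k)⁻¹) ^ 2 := by
    have : Lr ^ (k + 1) = Lr ^ k * Lr := pow_succ Lr k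
    rw [this]
    field_simp
  have hxk2 : ((Lr ^ k)⁻¹) ^ 2 ≤ 1 := pow_le_one₀ hxk0.le hxk1
  have h5L : ((((3 + 2) * F.L : ℕ) : ℝ) ^ 2) = 25 * Lr ^ 2 := by push_cast; rw [hLr]; ring
  have ht3 : ((((3 + 2) * F.L : ℕ) : ℝ) ^ 2 / 4) * (C68p * θ * ((Lr ^ (k + 1))⁻¹) ^ 2) < deltaSU (Fin 2) := by
    rw [h5L]
    have : 25 * Lr ^ 2 / 4 * (C68p * θ * ((Lr ^ (k + 1))⁻¹) ^ 2) = 25 / 4 * C68p * θ * (Lr ^ 2 * ((Lr ^ (k + 1))⁻¹) ^ 2) := by ring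
    rw [this, hsq]
    have hle : 25 / 4 * C68p * θ * ((Lr ^ k)⁻¹) ^ 2 ≤ 25 / 4 * C68p * θ :=
      mul_le_of_le_one_right (by positivity) hxk2
    have hδ : 0 < deltaSU (Fin 2) := deltaSU_pos
    linarith
  have hco : PlaqSmall ((Lr ^ 2 + 6 * ((((3 + 2) * F.L : ℕ) : ℝ) ^ 2)) * (C68p * θ * ((Lr ^ (k + 1))⁻¹) ^ 2)) (coarsenField F K U') :=
    plaqSmall_coarsenField F K ha0 haU' ht3
  have hco' : ∀ q, GaugeGroup.dist1 (GaugeField.plaqHol (coarsenField F K U') q) ≤ 151 * C68p * θ * ((Lr ^ k)⁻¹) ^ 2 := by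
    intro q
    have hq := hco q
    rw [h5L] at hq
    have : (Lr ^ 2 + 6 * (25 * Lr ^ 2)) * (C68p * θ * ((Lr ^ (k + 1))⁻¹) ^ 2) = 151 * C68p * θ * (Lr ^ 2 * ((Lr ^ (k + 1))⁻¹) ^ 2) := by
      ring
    rw [this, hsq] at hq
    exact hq.le
  -- the Lipschitz step: parameter t and its guards
  set t : ℝ := 151 * C68p * θ * ((Lr ^ (k - (1 + j)))⁻¹) ^ 2 with ht
  have ht0 : 0 ≤ t := by positivity
  have hxki : ((Lr ^ (k - (1 + j)))⁻¹) ^ 2 ≤ 1 := inv_pow_pow_le_one hL1 _ _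
  have htt₀ : t ≤ t₀ := by
    have : t ≤ 151 * C68p * θ := mul_le_of_le_one_right (by positivity) hxki
    linarith
  have htk : t * ((Lr ^ (1 + j))⁻¹) ^ 2 = 151 * C68p * θ * ((Lr ^ k)⁻¹) ^ 2 := by
    rw [ht, mul_assoc, inv_pow_sq_mul, Nat.sub_add_cancel hik]
  have hgU : ∀ q ∈ plaqsIn 0 (D.enl K (1 + j) Y), GaugeGroup.dist1 (GaugeField.plaqHol U q) ≤ t * ((Lr ^ (1 + j))⁻¹) ^ 2 := by
    intro q _
    rw [htk]
    refine (hplU q).trans ?_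
    have hx : 0 ≤ θ * ((Lr ^ k)⁻¹) ^ 2 := by positivity
    have hc : C68 ≤ 151 * C68p := by linarith
    calc C68 * θ * ((Lr ^ k)⁻¹) ^ 2 = C68 * (θ * ((Lr ^ k)⁻¹) ^ 2) := by ring
      _ ≤ 151 * C68p * (θ * ((Lr ^ k)⁻¹) ^ 2) := mul_le_mul_of_nonneg_right hc hx
      _ = 151 * C68p * θ * ((Lr ^ k)⁻¹) ^ 2 := by ring
  have hgco : ∀ q ∈ plaqsIn 0 (D.enl K (1 + j) Y),
      GaugeGroup.dist1 (GaugeField.plaqHol (coarsenField F K U') q) ≤ t * ((Lr ^ (1 + j))⁻¹) ^ 2 := by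
    intro q _
    rw [htk]
    exact hco' q
  -- the radius guard and the distance bound at level i
  have hmono : orbitDistOn F (bondsIn 0 (D.enl K (1 + j) Y)) (coarsenField F K U') U ≤ orbitDistOn F Set.univ (coarsenField F K U') U :=
    orbitDistOn_mono F (Set.subset_univ _) _ _
  have hd0 : 0 ≤ orbitDistOn F (bondsIn 0 (D.enl K (1 + j) Y)) (coarsenField F K U') U := orbitDistOn_nonneg F _ _ _
  have hLi : Lr ^ (1 + j) * ((Lr ^ k)⁻¹) ^ 2 ≤ 1 := by
    have h2k : Lr ^ (1 + j) ≤ Lr ^ k * Lr ^ k := by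
      rw [← pow_add]
      exact pow_le_pow_right₀ hL1 (by omega)
    have hkk : 0 < Lr ^ k * Lr ^ k := by positivity
    have hinv : ((Lr ^ k)⁻¹) ^ 2 = (Lr ^ k * Lr ^ k)⁻¹ := by rw [sq, mul_inv]
    rw [hinv, ← div_eq_mul_inv, div_le_one hkk]
    exact h2k
  have hbase : ((Lr ^ k)⁻¹) ^ a₁ ≤ ((Lr ^ (1 + j))⁻¹) ^ a₁ := by
    refine Real.rpow_le_rpow hxk0.le ?_ ha₁
    exact inv_anti₀ (by positivity) (pow_le_pow_right₀ hL1 hik)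
  have hLdist : Lr ^ (1 + j) * orbitDistOn F (bondsIn 0 (D.enl K (1 + j) Y)) (coarsenField F K U') U ≤
      max Cmc 0 * θ * ((Lr ^ (1 + j))⁻¹) ^ a₁ := by
    calc Lr ^ (1 + j) * orbitDistOn F (bondsIn 0 (D.enl K (1 + j) Y)) (coarsenField F K U') U
        ≤ Lr ^ (1 + j) * (max Cmc 0 * θ * ((Lr ^ k)⁻¹) ^ 2 * ((Lr ^ k)⁻¹) ^ a₁) :=
          mul_le_mul_of_nonneg_left (hmono.trans hdist') (by positivity)
      _ = (Lr ^ (1 + j) * ((Lr ^ k)⁻¹) ^ 2) * (max Cmc 0 * θ * ((Lr ^ k)⁻¹) ^ a₁) := by ring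
      _ ≤ 1 * (max Cmc 0 * θ * ((Lr ^ k)⁻¹) ^ a₁) := mul_le_mul_of_nonneg_right hLi (by positivity)
      _ = max Cmc 0 * θ * ((Lr ^ k)⁻¹) ^ a₁ := one_mul _
      _ ≤ max Cmc 0 * θ * ((Lr ^ (1 + j))⁻¹) ^ a₁ := mul_le_mul_of_nonneg_left hbase (by positivity)
  have hrad : Lr ^ (1 + j) * orbitDistOn F (bondsIn 0 (D.enl K (1 + j) Y)) (coarsenField F K U') U ≤ α₁ / 2 := by
    refine hLdist.trans ?_
    have hxi1 : ((Lr ^ (1 + j))⁻¹) ^ a₁ ≤ 1 :=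
      Real.rpow_le_one (by positivity) (inv_le_one_of_one_le₀ (one_le_pow₀ hL1)) ha₁
    have : max Cmc 0 * θ * ((Lr ^ (1 + j))⁻¹) ^ a₁ ≤ max Cmc 0 * θ := mul_le_of_le_one_right (by positivity) hxi1
    exact this.trans hg2
  -- second piece: Lipschitz
  have h2 : |D.Pterm K (1 + j) Y (coarsenField F K U') - D.Pterm K (1 + j) Y U| ≤
      CL * E * t ^ 2 * (Lr ^ (1 + j) * orbitDistOn F (bondsIn 0 (D.enl K (1 + j) Y)) (coarsenField F K U') U) / α₁ :=
    hLip.2 K (1 + j) Y (coarsenField F K U') U t ht0 htt₀ hgco hgU hrad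
  have h2' : |D.Pterm K (1 + j) Y (coarsenField F K U') - D.Pterm K (1 + j) Y U| ≤
      max CL 0 * (151 * (max C68 0 + 1)) ^ 2 * max Cmc 0 / α₁ * θ ^ 3 * E * ((Lr ^ (K - n - 1 - j))⁻¹) ^ 4 *
        ((Lr ^ (1 + j))⁻¹) ^ a₁ := by
    refine h2.trans ?_
    have hY0 : 0 ≤ E * t ^ 2 * (Lr ^ (1 + j) * orbitDistOn F (bondsIn 0 (D.enl K (1 + j) Y)) (coarsenField F K U') U) / α₁ := by
      positivity
    have step1 : CL * E * t ^ 2 * (Lr ^ (1 + j) * orbitDistOn F (bondsIn 0 (D.enl K (1 + j) Y)) (coarsenField F K U') U) / α₁ ≤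
        max CL 0 * E * t ^ 2 * (Lr ^ (1 + j) * orbitDistOn F (bondsIn 0 (D.enl K (1 + j) Y)) (coarsenField F K U') U) / α₁ := by
      have := mul_le_mul_of_nonneg_right (le_max_left CL 0) hY0
      calc CL * E * t ^ 2 * (Lr ^ (1 + j) * orbitDistOn F (bondsIn 0 (D.enl K (1 + j) Y)) (coarsenField F K U') U) / α₁
          = CL * (E * t ^ 2 * (Lr ^ (1 + j) * orbitDistOn F (bondsIn 0 (D.enl K (1 + j) Y)) (coarsenField F K U') U) / α₁) := by ring
        _ ≤ max CL 0 * (E * t ^ 2 * (Lr ^ (1 + j) * orbitDistOn F (bondsIn 0 (D.enl K (1 + j) Y)) (coarsenField F K U') U) / α₁) := this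
        _ = _ := by ring
    refine step1.trans ?_
    have step2 : max CL 0 * E * t ^ 2 * (Lr ^ (1 + j) * orbitDistOn F (bondsIn 0 (D.enl K (1 + j) Y)) (coarsenField F K U') U) / α₁ ≤
        max CL 0 * E * t ^ 2 * (max Cmc 0 * θ * ((Lr ^ (1 + j))⁻¹) ^ a₁) / α₁ := by
      have hc0 : 0 ≤ max CL 0 * E * t ^ 2 / α₁ := by positivity
      have := mul_le_mul_of_nonneg_left hLdist hc0
      calc max CL 0 * E * t ^ 2 * (Lr ^ (1 + j) * orbitDistOn F (bondsIn 0 (D.enl K (1 + j) Y)) (coarsenField F K U') U) / α₁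
          = max CL 0 * E * t ^ 2 / α₁ * (Lr ^ (1 + j) * orbitDistOn F (bondsIn 0 (D.enl K (1 + j) Y)) (coarsenField F K U') U) := by ring
        _ ≤ max CL 0 * E * t ^ 2 / α₁ * (max Cmc 0 * θ * ((Lr ^ (1 + j))⁻¹) ^ a₁) := this
        _ = _ := by ring
    refine step2.trans (le_of_eq ?_)
    rw [ht, hki, hC68p]
    ring
  -- triangle
  have hsplit : D.Pterm (K + 1) (1 + (j + 1)) (refineSet F K Y) U' - D.Pterm K (1 + j) Y U - c K n j Y =
      (D.Pterm (K + 1) (1 + (j + 1)) (refineSet F K Y) U' - D.Pterm K (1 + j) Y (coarsenField F K U') - c K n j Y) +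
        (D.Pterm K (1 + j) Y (coarsenField F K U') - D.Pterm K (1 + j) Y U) := by ring
  rw [hsplit]
  refine (abs_add_le _ _).trans (add_le_add h1' ?_)
  calc |D.Pterm K (1 + j) Y (coarsenField F K U') - D.Pterm K (1 + j) Y U|
      ≤ max CL 0 * (151 * (max C68 0 + 1)) ^ 2 * max Cmc 0 / α₁ * θ ^ 3 * E * ((Lr ^ (K - n - 1 - j))⁻¹) ^ 4 *
        ((Lr ^ (1 + j))⁻¹) ^ a₁ := h2'
    _ = _ := by rw [hE]

end Summit.QuantumFields.YangMills.Theorems.LogComparisonPolymerEstimate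

end
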